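import Summits.CriticalPhenomena.PercolationContinuityZ3.Theorems.Transplant.FKConnectivityAllQAntipodalX2WordsRows
import HarnessLib

/-!
# Connectivity correlation inequalities for `φ_{w,q}` — the TYPE-WORD MODEL of `X2`, file 3: the hull of a type word, first/last
# visible kinds, and the shape of an UNBALANCED end (memo g13 Lemma 3.3(a))

Helper file (`--supports stmt-CriticalPhenomena-4575`), FK sub-lane `prim-bschramm-fk-2` (gen 13); builds on p205010 (kernel
theorem, internal audit signed; external expert review pending).  Pure finite combinatorics on the model of `…AntipodalX2Words`
(memo `bschramm/FROM-fk-2-g13-WORD-HALL.md` §3).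
* `hullStart_eq_some_iff`, `hullEnd_eq_some_iff`, `hull_decomp` (`x = E^h ++ hull part ++ E^(n-1-h')`), `hullPart_spec`;
* `firstA_eq`, …, `lastB_eq`: the first/last visible kinds of RULE N read off the hull part;
* `unbalanced_head` / `unbalanced_last`: if the two rows of a word whose first (last) block is not ground start (end) differently,
  it is row `A` that shows the particle — the pattern `(W, P)` never occurs at a hull end (memo 3.3(a)).
[cite: Grimmett2006, §3.9 (p. 63)]
-/

namespace Summit.CriticalPhenomena.PercolationContinuityZ3.Theorems

namespace FK

namespace X2Word

/-! ### The hull of a type word -/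

section Hull

/-- Specification of `hullStart`. [folklore] -/
theorem hullStart_eq_some_iff (x : List Ty) (h : ℕ) :
    hullStart x = some h ↔ ∃ hh : h < x.length, x[h] ≠ .E ∧ ∀ j (hj : j < h), x[j] = .E := by
  unfold hullStart
  rw [List.findIdx?_eq_some_iff_getElem]
  constructor
  · rintro ⟨hh, h1, h2⟩
    exact ⟨hh, by simpa using h1, fun j hj => by simpa using h2 j hj⟩
  · rintro ⟨hh, h1, h2⟩
    exact ⟨hh, by simpa using h1, fun j hj => by simpa using h2 j hj⟩

/-- `hullStart x = none` iff `x` is the ground word. [folklore] -/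
theorem hullStart_eq_none_iff (x : List Ty) : hullStart x = none ↔ ∀ e ∈ x, e = .E := by
  unfold hullStart
  rw [List.findIdx?_eq_none_iff]
  simp

/-- Specification of `hullEnd`. [folklore] -/
theorem hullEnd_eq_some_iff (x : List Ty) (h' : ℕ) :
    hullEnd x = some h' ↔ ∃ hh : h' < x.length, x[h'] ≠ .E ∧ ∀ j (hj : j < x.length), h' < j → x[j] = .E := by
  unfold hullEnd
  constructor
  · intro hx
    obtain ⟨j, hj, rfl⟩ := Option.map_eq_some_iff.mp hx
    rw [List.findIdx?_eq_some_iff_getElem] at hj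
    obtain ⟨hjl, hj1, hj2⟩ := hj
    rw [List.length_reverse] at hjl
    refine ⟨by omega, ?_, ?_⟩
    · rw [List.getElem_reverse] at hj1; simpa using hj1
    · intro i hi hlt
      have := hj2 (x.length - 1 - i) (by omega)
      rw [List.getElem_reverse] at this
      simp only [ne_eq, decide_not, Bool.not_eq_eq_eq_not, Bool.not_true,
        decide_eq_false_iff_not, Decidable.not_not] at this
      have e : x.length - 1 - (x.length - 1 - i) = i := by omega
      simpa [e] using this
  · rintro ⟨hh, h1, h2⟩
    have : x.reverse.findIdx? (· ≠ .E) = some (x.length - 1 - h') := by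
      rw [List.findIdx?_eq_some_iff_getElem]
      refine ⟨by simp; omega, ?_, ?_⟩
      · rw [List.getElem_reverse]
        have e : x.length - 1 - (x.length - 1 - h') = h' := by omega
        simpa [e] using h1
      · intro j hj
        rw [List.getElem_reverse]
        simpa using h2 (x.length - 1 - j) (by omega) (by omega)
    rw [this, Option.map_some]
    congr 1; omega

/-- `hullEnd x = none` iff `x` is the ground word. [folklore] -/
theorem hullEnd_eq_none_iff (x : List Ty) : hullEnd x = none ↔ ∀ e ∈ x, e = .E := by
  unfold hullEnd
  simp [List.findIdx?_eq_none_iff]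

/-- A list all of whose entries are `E` is a ground word `E^n`. [folklore] -/
theorem eq_replicate_of_allE {l : List Ty} (h : ∀ e ∈ l, e = .E) : l = List.replicate l.length .E :=
  List.eq_replicate_iff.mpr ⟨rfl, h⟩

/-- The HULL DECOMPOSITION: a word with hull `[h, h']` is `E^h ++ hp ++ E^(n-1-h')` with `hp` its hull part. [folklore] -/
theorem hull_decomp {x : List Ty} {h h' : ℕ} (hs : hullStart x = some h) (he : hullEnd x = some h') :
    h ≤ h' ∧ h' < x.length ∧
      x = List.replicate h .E ++ (x.drop h).take (h' + 1 - h) ++ List.replicate (x.length - 1 - h') .E := by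
  obtain ⟨hh, hx1, hx2⟩ := (hullStart_eq_some_iff x h).mp hs
  obtain ⟨hh', hx1', hx2'⟩ := (hullEnd_eq_some_iff x h').mp he
  have hle : h ≤ h' := by
    by_contra hlt
    exact hx1 (hx2' h hh (by omega))
  refine ⟨hle, hh', ?_⟩
  have e1 : x.take h = List.replicate h .E := by
    apply List.ext_getElem (by simp; omega)
    intro j hj1 hj2
    simp only [List.getElem_take, List.getElem_replicate]
    exact hx2 j (by simpa using hj2)
  have e2 : x.drop (h' + 1) = List.replicate (x.length - 1 - h') .E := by
    apply List.ext_getElem (by simp; omega)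
    intro j hj1 hj2
    simp only [List.getElem_drop, List.getElem_replicate]
    exact hx2' _ _ (by omega)
  calc x = x.take h ++ x.drop h := (List.take_append_drop h x).symm
    _ = x.take h ++ ((x.drop h).take (h' + 1 - h) ++ (x.drop h).drop (h' + 1 - h)) := by
        congr 1; exact (List.take_append_drop _ _).symm
    _ = _ := by rw [List.drop_drop, show h + (h' + 1 - h) = h' + 1 by omega, e1, e2, List.append_assoc]

/-- The hull part is nonempty, starts and ends with a non-ground block. [folklore] -/
theorem hullPart_spec {x : List Ty} {h h' : ℕ} (hs : hullStart x = some h) (he : hullEnd x = some h') :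
    ((x.drop h).take (h' + 1 - h)).length = h' + 1 - h ∧
      ∃ (h0 : 0 < ((x.drop h).take (h' + 1 - h)).length),
        ((x.drop h).take (h' + 1 - h))[0] ≠ .E ∧
          ((x.drop h).take (h' + 1 - h))[((x.drop h).take (h' + 1 - h)).length - 1] ≠ .E := by
  obtain ⟨hh, hx1, -⟩ := (hullStart_eq_some_iff x h).mp hs
  obtain ⟨hh', hx1', -⟩ := (hullEnd_eq_some_iff x h').mp he
  obtain ⟨hle, -, -⟩ := hull_decomp hs he
  have hlen : ((x.drop h).take (h' + 1 - h)).length = h' + 1 - h := by simp; omega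
  refine ⟨hlen, by omega, ?_, ?_⟩
  · simpa [List.getElem_take, List.getElem_drop] using hx1
  · simp only [List.getElem_take, List.getElem_drop, hlen]
    have e : h + (h' + 1 - h - 1) = h' := by omega
    simpa [e] using hx1'

end Hull

/-! ### First and last visible kinds, read off the hull part -/

section Visible

/-- `kindAt` composes additively. [folklore] -/
theorem kindAt_add (k₀ : Kind) (a n : ℕ) : kindAt k₀ (a + n) = kindAt (kindAt k₀ a) n := by
  rw [Nat.add_comm]
  simp [kindAt, Function.iterate_add_apply]

/-- The block before block `h ≥ 1` has the other kind. [folklore] -/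
theorem kindAt_pred {k₀ : Kind} {h : ℕ} (hh : 1 ≤ h) : kindAt k₀ (h - 1) = (kindAt k₀ h).other := by
  obtain ⟨m, rfl⟩ : ∃ m, h = m + 1 := ⟨h - 1, by omega⟩
  simp [kindAt_succ]

/-- Row `A` of a ground word is empty or not; either way appending it after a nonempty word keeps `head?`. [folklore] -/
theorem head?_append_of_ne_nil {α : Type*} {l : List α} (l' : List α) (h : l ≠ []) : (l ++ l').head? = l.head? := by
  cases l with
  | nil => exact absurd rfl h
  | cons a l => rfl

/-- `getLast?` of a concatenation with a nonempty second part. [folklore] -/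
theorem getLast?_append_of_ne_nil' {α : Type*} (l : List α) {l' : List α} (h : l' ≠ []) :
    (l ++ l').getLast? = l'.getLast? := by
  obtain ⟨a, ha⟩ : ∃ a, l'.getLast? = some a := by
    cases hl : l'.getLast? with
    | none => exact absurd (List.getLast?_eq_none_iff.mp hl) h
    | some a => exact ⟨a, rfl⟩
  simp [List.getLast?_append, ha]

variable {k₀ : Kind} {x : List Ty} {h h' : ℕ}

/-- `firstA` read off the hull part (when its row `A` is nonempty). [folklore] -/
theorem firstA_eq (hs : hullStart x = some h) (he : hullEnd x = some h')
    (hA : rowA (kindAt k₀ h) ((x.drop h).take (h' + 1 - h)) ≠ []) :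
    firstA k₀ x h = (rowA (kindAt k₀ h) ((x.drop h).take (h' + 1 - h))).head? := by
  obtain ⟨hle, hh', hx⟩ := hull_decomp hs he
  set hp := (x.drop h).take (h' + 1 - h) with hhp
  unfold firstA
  have hd : x.drop h = hp ++ List.replicate (x.length - 1 - h') .E := by
    conv_lhs => rw [hx]
    rw [List.append_assoc, List.drop_left' (by simp)]
  rw [hd, rowA_append, head?_append_of_ne_nil _ hA]

/-- `firstB` read off the hull part. [folklore] -/
theorem firstB_eq (hs : hullStart x = some h) (he : hullEnd x = some h')
    (hB : rowB (kindAt k₀ h) ((x.drop h).take (h' + 1 - h)) ≠ []) :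
    firstB k₀ x h = (rowB (kindAt k₀ h) ((x.drop h).take (h' + 1 - h))).head? := by
  obtain ⟨hle, hh', hx⟩ := hull_decomp hs he
  set hp := (x.drop h).take (h' + 1 - h) with hhp
  unfold firstB
  have hd : x.drop h = hp ++ List.replicate (x.length - 1 - h') .E := by
    conv_lhs => rw [hx]
    rw [List.append_assoc, List.drop_left' (by simp)]
  rw [hd, rowB_append, head?_append_of_ne_nil _ hB]

/-- `lastA` read off the hull part. [folklore] -/
theorem lastA_eq (hs : hullStart x = some h) (he : hullEnd x = some h')
    (hA : rowA (kindAt k₀ h) ((x.drop h).take (h' + 1 - h)) ≠ []) :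
    lastA k₀ x h' = (rowA (kindAt k₀ h) ((x.drop h).take (h' + 1 - h))).getLast? := by
  obtain ⟨hle, hh', hx⟩ := hull_decomp hs he
  set hp := (x.drop h).take (h' + 1 - h) with hhp
  have hlen : hp.length = h' + 1 - h := by simp [hhp]; omega
  unfold lastA
  have ht : x.take (h' + 1) = List.replicate h .E ++ hp := by
    conv_lhs => rw [hx]
    rw [List.take_left' (by simp [hlen]; omega)]
  rw [ht, rowA_append, List.length_replicate, getLast?_append_of_ne_nil' _ hA]

/-- `lastB` read off the hull part. [folklore] -/
theorem lastB_eq (hs : hullStart x = some h) (he : hullEnd x = some h')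
    (hB : rowB (kindAt k₀ h) ((x.drop h).take (h' + 1 - h)) ≠ []) :
    lastB k₀ x h' = (rowB (kindAt k₀ h) ((x.drop h).take (h' + 1 - h))).getLast? := by
  obtain ⟨hle, hh', hx⟩ := hull_decomp hs he
  set hp := (x.drop h).take (h' + 1 - h) with hhp
  have hlen : hp.length = h' + 1 - h := by simp [hhp]; omega
  unfold lastB
  have ht : x.take (h' + 1) = List.replicate h .E ++ hp := by
    conv_lhs => rw [hx]
    rw [List.take_left' (by simp [hlen]; omega)]
  rw [ht, rowB_append, List.length_replicate, getLast?_append_of_ne_nil' _ hB]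

/-- `headP` in terms of `head?`. [folklore] -/
theorem headP_eq_decide (l : List Kind) : headP l = decide (l.head? = some .P) := rfl

/-- `lastP` in terms of `getLast?`. [folklore] -/
theorem lastP_eq_decide (l : List Kind) : lastP l = decide (l.getLast? = some .P) := rfl

end Visible

/-! ### Unbalanced ends (memo g13 Lemma 3.3) -/

section Unbalanced

/-- Row `A` of a singleton. [folklore] -/
theorem rowA_singleton (k : Kind) (e : Ty) : rowA k [e] = if visA k e then [k] else [] := by
  simp [rowA_cons]

/-- Row `B` of a singleton. [folklore] -/
theorem rowB_singleton (k : Kind) (e : Ty) : rowB k [e] = if visB k e then [k] else [] := by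
  simp [rowB_cons]

/-- If the first block of `hp` is not ground and the two rows of `hp` start differently (one with a particle, the other not), then
it is row `A` that starts with the particle (memo g13 3.3(a): the pattern `(W,P)` never occurs at a hull start). [folklore] -/
theorem unbalanced_head (k : Kind) {e : Ty} (he : e ≠ .E) (l : List Ty)
    (hunb : headP (rowA k (e :: l)) ≠ headP (rowB k (e :: l))) :
    headP (rowA k (e :: l)) = true ∧ headP (rowB k (e :: l)) = false := by
  revert hunb
  cases e with
  | E => exact absurd rfl he
  | M => cases k <;> simp [rowA_cons, rowB_cons, visA, visB, headP]
  | F => cases k <;> simp [rowA_cons, rowB_cons, visA, visB, headP]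

/-- Mirror image of `unbalanced_head` at the right end: if the last block is not ground and the rows end differently, row `A` ends
with the particle. [folklore] -/
theorem unbalanced_last (k : Kind) (l : List Ty) {e : Ty} (he : e ≠ .E)
    (hunb : lastP (rowA k (l ++ [e])) ≠ lastP (rowB k (l ++ [e]))) :
    lastP (rowA k (l ++ [e])) = true ∧ lastP (rowB k (l ++ [e])) = false := by
  revert hunb
  rw [rowA_append, rowB_append, rowA_singleton, rowB_singleton]
  generalize kindAt k l.length = k'
  cases e with
  | E => exact absurd rfl he
  | M => cases k' <;> simp [visA, visB, lastP]
  | F => cases k' <;> simp [visA, visB, lastP]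

end Unbalanced


end X2Word

end FK

end Summit.CriticalPhenomena.PercolationContinuityZ3.Theorems
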